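import Summits.SmoothPoincare4.SmoothPoincare4.Theorems.CylinderEntropyThinCrossSectionExistsStubHamiltonConvex
import Summits.SmoothPoincare4.SmoothPoincare4.Theorems.CylinderEntropyThinCrossSectionExistsStubHarnackRadialOfConvex
import Summits.SmoothPoincare4.SmoothPoincare4.Theorems.CylinderEntropyThinCrossSectionExistsStubZonalMonotone
import Summits.SmoothPoincare4.SmoothPoincare4.Theorems.CylinderEntropyThinCrossSectionExistsStubKernelDomination
import Summits.SmoothPoincare4.SmoothPoincare4.Theorems.CylinderEntropyThinCrossSectionExistsStubLevelComparison
import Summits.SmoothPoincare4.SmoothPoincare4.Theorems.CylinderEntropyThinCrossSectionExistsStubLayerCakeCore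
import HarnessLib

/-!
# The ball-mass lever of line `ball-mass-slack`: `λ_cyl(S) ≤ m_N(S) · λ_cyl(slice)` — unconditional

Crux `CylinderEntropy.ThinCrossSectionExists` (`stmt-SmoothPoincare4-7633`), line `ball-mass-slack`: all six analytic /
measure-theoretic stubs of the line are landed and PROVED — `stub_hamiltonConvex` (p93995: Hamilton's matrix Harnack
estimate for the heat kernel of the round `S⁴` in radial form, proved in the tree via
`Literature.Geometry.Riemannian.SphericalZonalHamiltonHarnack`), `stub_harnackRadial_of_convex` (p78724),
`stub_zonalMonotone` (p86444: Cheeger–Yau radial monotonicity, proved via positivity of the `S⁶` kernel),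
`stub_kernelDomination` (p88929), `stub_levelComparison` (p78255), `stub_layerCakeCore` (p78271).  They compose into
the line's LEVER, now a theorem with no hypothesis beyond the geometry of `S`.

For a subset `S` of the round cylinder `N = S⁴×ℝ = {∑_{i<5} zᵢ² = 1} ⊂ ℝ⁶` say that `S` has `Λ`-SUBSPHERICAL INTRINSIC BALL
MASS if every closed intrinsic ball `B̄ᴺ(q,r) = {y ∈ N | arccos⟨y',q'⟩² + (y₅-q₅)² ≤ r²}` (`q ∈ N`, `r > 0`) carries at most `Λ`
times the `μH⁴`-mass on `S` that the slice `S⁴×{0}` carries in the ball of the same radius about its own point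
`e₀ = (1,0,0,0,0,0)` (all spelled out inline, exactly as in the registered stubs).  Then:

* `ballMass_cylDensity_le` — `F̂_{p,τ}(S) ≤ Λ · F̂_{e₀,τ}(slice)` for every centre `p ∈ N` and scale `τ > 0`;
* `ballMass_cylEntropy_le_mul` — **`λ_cyl(S) ≤ Λ · λ_cyl(slice)`** (calibration-free);
* `ballMass_cylEntropy_le` — `λ_cyl(S) ≤ Λ` given the `≤ 1` half `λ_cyl(slice) ≤ 1` of the route's support item
  `SliceCalibration` (7634);
* `cylEntropy_le_mul_of_ballMass` — the registered sub-goal (same statement with Hamilton's convexity as an explicit,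
  now redundant, hypothesis).

An SPC4-free upper-bound tool for the sibling cruxes `CylinderRungTwo` / `SliceIsolation` and for any numerical certificate:
the transcendental sup-functional `λ_cyl` is bounded by the elementary ball-mass ratio, constant exactly `1`.
Pure logic over the landed stubs; no definitions, no facts.
-/

noncomputable section

open scoped BigOperators Topology MeasureTheory ENNReal NNReal
open Set Function MeasureTheory
open Literature.Geometry.Riemannian.SphericalCylinderEntropy (cylEntropy cylDensity cylKernel zonal)

set_option linter.dupNamespace false

namespace Summit.SmoothPoincare4.SmoothPoincare4.Theorems.ThinCrossSectionExists.BallMassSlack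

/-- The base point `e₀ = (1,0,0,0,0,0)` lies on `N`. [folklore] -/
theorem sum_sq_single_zero_one :
    ∑ i : Fin 5, (EuclideanSpace.single 0 1 : EuclideanSpace ℝ (Fin 6)) (Fin.castSucc i) ^ 2 = 1 := by
  rw [Finset.sum_eq_single (0 : Fin 5)]
  · simp
  · intro i _ hi
    have : (Fin.castSucc i : Fin 6) ≠ 0 := fun h => hi (Fin.castSucc_eq_zero_iff.1 h)
    simp [this]
  · simp

/-- **The lever, relative form at one centre and scale**: if `S ⊆ N` has `Λ`-subspherical intrinsic ball mass
then `F̂_{p,τ}(S) ≤ Λ · F̂_{e₀,τ}(slice)` for every `p ∈ N`, `τ > 0`.  Composition of the stubs C-dom (profile), C-level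
(per-level slack) and C-core (layer cake), with A' applied to H (Hamilton) and B (Cheeger–Yau). [folklore] -/
theorem ballMass_cylDensity_le
    {Λ : ℝ≥0∞} {S : Set (EuclideanSpace ℝ (Fin 6))} (hS : ∀ y ∈ S, ∑ i : Fin 5, y (Fin.castSucc i) ^ 2 = 1)
    (hm : ∀ q : EuclideanSpace ℝ (Fin 6), ∑ i : Fin 5, q (Fin.castSucc i) ^ 2 = 1 → ∀ r : ℝ, 0 < r →
        μH[4] (S ∩ {y : EuclideanSpace ℝ (Fin 6) | ∑ i : Fin 5, y (Fin.castSucc i) ^ 2 = 1 ∧ Real.arccos (∑ i : Fin 5, y (Fin.castSucc i) * q (Fin.castSucc i)) ^ 2 + (y 5 - q 5) ^ 2 ≤ r ^ 2}) ≤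
          Λ * μH[4] ({z : EuclideanSpace ℝ (Fin 6) | ∑ i : Fin 5, z (Fin.castSucc i) ^ 2 = 1 ∧ z 5 = 0} ∩
            {y : EuclideanSpace ℝ (Fin 6) | ∑ i : Fin 5, y (Fin.castSucc i) ^ 2 = 1 ∧ Real.arccos (∑ i : Fin 5, y (Fin.castSucc i) * (EuclideanSpace.single 0 1 : EuclideanSpace ℝ (Fin 6)) (Fin.castSucc i)) ^ 2 + (y 5 - (EuclideanSpace.single 0 1 : EuclideanSpace ℝ (Fin 6)) 5) ^ 2 ≤ r ^ 2}))
    {p : EuclideanSpace ℝ (Fin 6)} (hp : ∑ i : Fin 5, p (Fin.castSucc i) ^ 2 = 1) {τ : ℝ} (hτ : 0 < τ) :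
    cylDensity S p τ ≤ Λ * cylDensity {z : EuclideanSpace ℝ (Fin 6) | ∑ i : Fin 5, z (Fin.castSucc i) ^ 2 = 1 ∧ z 5 = 0} (EuclideanSpace.single 0 1 : EuclideanSpace ℝ (Fin 6)) τ := by
  obtain ⟨F, hFa, hF0, hdom, hex⟩ :=
    stub_kernelDomination (stub_harnackRadial_of_convex stub_hamiltonConvex) stub_zonalMonotone τ hτ
  exact stub_layerCakeCore τ Λ S F p hS hFa hF0 hp (fun y hy => hdom p y hp hy) hex
    (fun t _ => stub_levelComparison Λ S F p t hS hm hFa hp)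

/-- **The lever, calibration-free absolute form: `λ_cyl(S) ≤ Λ · λ_cyl(slice)`** for every `S ⊆ N` with
`Λ`-subspherical intrinsic ball mass. [folklore] -/
theorem ballMass_cylEntropy_le_mul
    {Λ : ℝ≥0∞} {S : Set (EuclideanSpace ℝ (Fin 6))} (hS : ∀ y ∈ S, ∑ i : Fin 5, y (Fin.castSucc i) ^ 2 = 1)
    (hm : ∀ q : EuclideanSpace ℝ (Fin 6), ∑ i : Fin 5, q (Fin.castSucc i) ^ 2 = 1 → ∀ r : ℝ, 0 < r →
        μH[4] (S ∩ {y : EuclideanSpace ℝ (Fin 6) | ∑ i : Fin 5, y (Fin.castSucc i) ^ 2 = 1 ∧ Real.arccos (∑ i : Fin 5, y (Fin.castSucc i) * q (Fin.castSucc i)) ^ 2 + (y 5 - q 5) ^ 2 ≤ r ^ 2}) ≤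
          Λ * μH[4] ({z : EuclideanSpace ℝ (Fin 6) | ∑ i : Fin 5, z (Fin.castSucc i) ^ 2 = 1 ∧ z 5 = 0} ∩
            {y : EuclideanSpace ℝ (Fin 6) | ∑ i : Fin 5, y (Fin.castSucc i) ^ 2 = 1 ∧ Real.arccos (∑ i : Fin 5, y (Fin.castSucc i) * (EuclideanSpace.single 0 1 : EuclideanSpace ℝ (Fin 6)) (Fin.castSucc i)) ^ 2 + (y 5 - (EuclideanSpace.single 0 1 : EuclideanSpace ℝ (Fin 6)) 5) ^ 2 ≤ r ^ 2})) :
    cylEntropy S ≤ Λ * cylEntropy {z : EuclideanSpace ℝ (Fin 6) | ∑ i : Fin 5, z (Fin.castSucc i) ^ 2 = 1 ∧ z 5 = 0} := by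
  refine iSup₂_le fun p hp => iSup₂_le fun τ hτ => ?_
  calc cylDensity S p τ ≤ Λ * cylDensity {z : EuclideanSpace ℝ (Fin 6) | ∑ i : Fin 5, z (Fin.castSucc i) ^ 2 = 1 ∧ z 5 = 0} (EuclideanSpace.single 0 1 : EuclideanSpace ℝ (Fin 6)) τ := ballMass_cylDensity_le hS hm hp hτ
    _ ≤ Λ * cylEntropy {z : EuclideanSpace ℝ (Fin 6) | ∑ i : Fin 5, z (Fin.castSucc i) ^ 2 = 1 ∧ z 5 = 0} := by
        gcongr
        exact le_iSup_of_le (EuclideanSpace.single 0 1 : EuclideanSpace ℝ (Fin 6)) (le_iSup_of_le sum_sq_single_zero_one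
          (le_iSup_of_le τ (le_iSup_of_le hτ le_rfl)))

/-- **The lever with the calibration: `λ_cyl(S) ≤ Λ`** given the `≤ 1` half of the route's item `SliceCalibration`
(`λ_cyl(S⁴×{0}) ≤ 1`). [folklore] -/
theorem ballMass_cylEntropy_le
    (hcal : cylEntropy {z : EuclideanSpace ℝ (Fin 6) | ∑ i : Fin 5, z (Fin.castSucc i) ^ 2 = 1 ∧ z 5 = 0} ≤ 1)
    {Λ : ℝ≥0∞} {S : Set (EuclideanSpace ℝ (Fin 6))} (hS : ∀ y ∈ S, ∑ i : Fin 5, y (Fin.castSucc i) ^ 2 = 1)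
    (hm : ∀ q : EuclideanSpace ℝ (Fin 6), ∑ i : Fin 5, q (Fin.castSucc i) ^ 2 = 1 → ∀ r : ℝ, 0 < r →
        μH[4] (S ∩ {y : EuclideanSpace ℝ (Fin 6) | ∑ i : Fin 5, y (Fin.castSucc i) ^ 2 = 1 ∧ Real.arccos (∑ i : Fin 5, y (Fin.castSucc i) * q (Fin.castSucc i)) ^ 2 + (y 5 - q 5) ^ 2 ≤ r ^ 2}) ≤
          Λ * μH[4] ({z : EuclideanSpace ℝ (Fin 6) | ∑ i : Fin 5, z (Fin.castSucc i) ^ 2 = 1 ∧ z 5 = 0} ∩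
            {y : EuclideanSpace ℝ (Fin 6) | ∑ i : Fin 5, y (Fin.castSucc i) ^ 2 = 1 ∧ Real.arccos (∑ i : Fin 5, y (Fin.castSucc i) * (EuclideanSpace.single 0 1 : EuclideanSpace ℝ (Fin 6)) (Fin.castSucc i)) ^ 2 + (y 5 - (EuclideanSpace.single 0 1 : EuclideanSpace ℝ (Fin 6)) 5) ^ 2 ≤ r ^ 2})) :
    cylEntropy S ≤ Λ :=
  calc cylEntropy S ≤ Λ * cylEntropy {z : EuclideanSpace ℝ (Fin 6) | ∑ i : Fin 5, z (Fin.castSucc i) ^ 2 = 1 ∧ z 5 = 0} := ballMass_cylEntropy_le_mul hS hm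
    _ ≤ Λ * 1 := by gcongr
    _ = Λ := mul_one Λ

/-- The registered sub-goal of the line (`cylEntropy_le_mul_of_ballMass`): the lever under Hamilton's logarithmic
convexity as an explicit hypothesis — now redundant (`stub_hamiltonConvex` is proved), kept with its registered signature.
[folklore] -/
theorem cylEntropy_le_mul_of_ballMass :
    (∀ τ : ℝ, 0 < τ →
      (∀ θ : ℝ, 0 < zonal τ (Real.cos θ)) ∧
        ConvexOn ℝ (Set.Icc (-Real.pi) Real.pi)
          (fun θ : ℝ => Real.log (zonal τ (Real.cos θ)) + θ ^ 2 / (4 * τ))) →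
    ∀ {Λ : ℝ≥0∞} {S : Set (EuclideanSpace ℝ (Fin 6))}, (∀ y ∈ S, ∑ i : Fin 5, y (Fin.castSucc i) ^ 2 = 1) →
    (∀ q : EuclideanSpace ℝ (Fin 6), ∑ i : Fin 5, q (Fin.castSucc i) ^ 2 = 1 → ∀ r : ℝ, 0 < r →
        μH[4] (S ∩ {y : EuclideanSpace ℝ (Fin 6) | ∑ i : Fin 5, y (Fin.castSucc i) ^ 2 = 1 ∧ Real.arccos (∑ i : Fin 5, y (Fin.castSucc i) * q (Fin.castSucc i)) ^ 2 + (y 5 - q 5) ^ 2 ≤ r ^ 2}) ≤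
          Λ * μH[4] ({z : EuclideanSpace ℝ (Fin 6) | ∑ i : Fin 5, z (Fin.castSucc i) ^ 2 = 1 ∧ z 5 = 0} ∩
            {y : EuclideanSpace ℝ (Fin 6) | ∑ i : Fin 5, y (Fin.castSucc i) ^ 2 = 1 ∧ Real.arccos (∑ i : Fin 5, y (Fin.castSucc i) * (EuclideanSpace.single 0 1 : EuclideanSpace ℝ (Fin 6)) (Fin.castSucc i)) ^ 2 + (y 5 - (EuclideanSpace.single 0 1 : EuclideanSpace ℝ (Fin 6)) 5) ^ 2 ≤ r ^ 2})) →
    cylEntropy S ≤ Λ * cylEntropy {z : EuclideanSpace ℝ (Fin 6) | ∑ i : Fin 5, z (Fin.castSucc i) ^ 2 = 1 ∧ z 5 = 0} := by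
  intro _ Λ S hS hm
  exact ballMass_cylEntropy_le_mul hS hm

end Summit.SmoothPoincare4.SmoothPoincare4.Theorems.ThinCrossSectionExists.BallMassSlack

end
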